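import Summits.BirchSwinnertonDyer.BirchSwinnertonDyer.Theorems.GenusKolyvaginAtTwoPowDvdShaCardAtTwoRTLocalKernelQuadratic
import HarnessLib

/-!
# Route `GenusKolyvaginAtTwo`, LINE 18 / LINE 19 (stmt-BirchSwinnertonDyer-23242 / -23379), bit accounting of the `d_K`-relaxation:
# AT A QUADRATIC PLACE MATSUNO'S `W_{v,K}` IS KILLED BY `2`

Seat `bsd-line-gk2-p3` g16 (cell `bsd-f1-sign2`), `--supports stmt-BirchSwinnertonDyer-23242` (helper; closes nothing).  THEOREMS ONLY,
UNCONDITIONAL; BSD is not proved by any of this.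

Complement to `localKernel_eq_bot_of_finrank_eq_two_of_forall_two_smul` (this seat): with NO hypothesis on `E(K_w)`, at a place with
`[K_w : ℚ_v] = 2` every class of `W_{v,K} = ker(H¹(ℚ_v, E) → H¹(K_w, E))` is `2`-torsion ("`cor ∘ res = 2`"): the kernel is inflated
from `Γ_{ℚ_v}/galRange(K_w)`, a group of order `2` (`galRange_eq_fixingSubgroup_fieldRange`, Mathlib
`IntermediateField.finrank_eq_fixingSubgroup_index`), and `[G : N]` kills inflated classes (`index_nsmul_inflClass`).  So the
relaxed local condition of the (+)-descent at a ramified `p ∣ d_K` differs from the Selmer condition by a `2`-TORSION group (of order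
`#Ẽ(𝔽_p)[2]` by Kramer 1981 Prop. 3; one bit at a transposition prime).

* `two_nsmul_eq_zero_of_mem_localRestrictionKer_of_finrank_eq_two` — general char-`0` field `F`, quadratic `L/F`.
* `two_nsmul_eq_zero_of_mem_localKernel` — Matsuno's `W_{v,K}` for `E/ℚ`, `[K_w : ℚ_v] = 2`.

References: [SerreGaloisCohomology1997] I.§2.4 (Cor. to Prop. 9); [Matsuno2009] §3; [Kramer1981] §2 Prop. 3.
-/

set_option autoImplicit false
-- the Theorems namespace of this sub repeats the summit name by design (D-0017 nested layout)
set_option linter.dupNamespace false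

noncomputable section

open scoped Classical

namespace Summit.BirchSwinnertonDyer.BirchSwinnertonDyer.Theorems.GenusExact.PlusDescent

open WeierstrassCurve Literature.NumberTheory.EllipticCurves Literature.NumberTheory.GaloisRepresentations
  Literature.Barriers.BirchSwinnertonDyer IntermediateField NumberField IsDedekindDomain

universe u

/-- **`ker(H¹(F, E) → H¹(L, E))` is killed by `2` for a quadratic extension `L/F`** (`F` of characteristic `0`, any Weierstrass
curve): the kernel is inflated from `Γ_F / Γ_{j(L)}`, of order `[L : F] = 2`. Serre, *Galois Cohomology*, I.§2.4, Cor. to Prop. 9.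
[cite: SerreGaloisCohomology1997, I.§2.4 Cor. to Prop. 9] -/
theorem two_nsmul_eq_zero_of_mem_localRestrictionKer_of_finrank_eq_two {F : Type u} [Field F] [CharZero F]
    (W : WeierstrassCurve F) (L : Type u) [Field L] [Algebra F L] [FiniteDimensional F L]
    (h2 : Module.finrank F L = 2) {c : W.galH1} (hc : c ∈ W.localRestrictionKer L) : 2 • c = 0 := by
  haveI : Algebra.IsAlgebraic F L := Algebra.IsAlgebraic.of_finite F L
  haveI : IsGalois F (AlgebraicClosure F) := {}
  set e : AlgebraicClosure F ≃ₐ[F] AlgebraicClosure L := algEquivOfEmb L (closureEmb (K := F) L) with he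
  set j : L →ₐ[F] AlgebraicClosure F :=
    ((e.symm : AlgebraicClosure L →ₐ[F] AlgebraicClosure F).comp
      (IsScalarTower.toAlgHom F L (AlgebraicClosure L))) with hj
  set F' : IntermediateField F (AlgebraicClosure F) := j.fieldRange with hF'
  set N : Subgroup (Field.absoluteGaloisGroup F) := galRange (K := F) L with hNdef
  have hN : N = F'.fixingSubgroup := galRange_eq_fixingSubgroup_fieldRange L
  let eL : L ≃ₐ[F] F' := AlgHom.equivFieldRange j
  haveI : FiniteDimensional F F' := LinearEquiv.finiteDimensional eL.toLinearEquiv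
  have hNopen : IsOpen (N : Set (Field.absoluteGaloisGroup F)) := by
    rw [hN]; exact IntermediateField.fixingSubgroup_isOpen F'
  have hidx : N.index = 2 := by
    rw [hN]
    refine ((IntermediateField.finrank_eq_fixingSubgroup_index F').symm.trans ?_)
    rw [← eL.toLinearEquiv.finrank_eq, h2]
  haveI : N.FiniteIndex := ⟨by rw [hidx]; norm_num⟩
  obtain ⟨f, hf⟩ := resKer_le_range_inflClass (resGal (K := F) L) (pointsMap W L) (pointsMap_smul W L)
    (pointsMapOfEmb_bijective L W _) N hNopen (by rw [hNdef]; exact le_rfl) hc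
  rw [← hf, ← hidx]
  exact index_nsmul_inflClass N hNopen f

/-- **Matsuno's `W_{v,K}` is killed by `2` at a quadratic place**: for `E/ℚ`, a number field `K` and finite places `w ∣ v` with
`[K_w : ℚ_v] = 2`, every `c ∈ W_{v,K} = ker(H¹(ℚ_v, E) → H¹(K_w, E))` satisfies `2 • c = 0` — the `d_K`-relaxed local condition
of a class descended from `K` exceeds the Selmer condition by `2`-torsion only. [cite: Matsuno2009, §3 (p. 451, W_{v,K})]
[cite: SerreGaloisCohomology1997, I.§2.4 Cor. to Prop. 9] -/
theorem two_nsmul_eq_zero_of_mem_localKernel (E : WeierstrassCurve ℚ) (K : Type) [Field K] [NumberField K]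
    (v : HeightOneSpectrum (𝓞 ℚ)) (w : HeightOneSpectrum (𝓞 K)) [w.asIdeal.LiesOver v.asIdeal]
    (h2 : letI : Algebra (v.adicCompletion ℚ) (w.adicCompletion K) :=
        (Literature.NumberTheory.EllipticCurves.adicCompletionMap (K := ℚ) K v w).toAlgebra
      Module.finrank (v.adicCompletion ℚ) (w.adicCompletion K) = 2)
    {c : (E.baseChange (v.adicCompletion ℚ)).galH1} (hc : c ∈ Matsuno2009.localKernel E K v w) : 2 • c = 0 := by
  letI : Algebra (v.adicCompletion ℚ) (w.adicCompletion K) :=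
    (Literature.NumberTheory.EllipticCurves.adicCompletionMap (K := ℚ) K v w).toAlgebra
  haveI : CharZero (v.adicCompletion ℚ) :=
    charZero_of_injective_algebraMap (algebraMap ℚ (v.adicCompletion ℚ)).injective
  haveI : FiniteDimensional (v.adicCompletion ℚ) (w.adicCompletion K) := Module.finite_of_finrank_eq_succ h2
  exact two_nsmul_eq_zero_of_mem_localRestrictionKer_of_finrank_eq_two _ (w.adicCompletion K) h2 hc

end Summit.BirchSwinnertonDyer.BirchSwinnertonDyer.Theorems.GenusExact.PlusDescent

end
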